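import Literature.NumberTheory.LFunctions.PrimesInRayClasses
import Literature.NumberTheory.GaloisRepresentations.ChebotarevCyclotomicProofs
import Literature.NumberTheory.GaloisRepresentations.CyclotomicFrobenius
import HarnessLib

/-!
# Serre's congruence subgroup property for `SL₂(𝓞_F)` — proofs, II: the Dirichlet-type inputs

Topic `Literature/NumberTheory/Automorphic`; namespace `Literature.NumberTheory.Automorphic`
(sub-namespace `SerreSL2`).  Everything here is PROVED; no named facts.

The arithmetic of the Moore-free proof of `SerreSL2Congruence1970_congruenceSubgroupProperty`
(Vaserstein 1972 + Bass–Milnor–Serre 1967, see `CongruenceSubgroupPropertySL2Proofs.lean`) uses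
"Dirichlet's theorem" in the following two forms, both appearing in Bass–Milnor–Serre's appendix on
number theory ((A.8), (A.10)–(A.11)) and in Serre 1970, §2.3 (Lemme 4, there via the existence
theorem of class field theory and Čebotarev in `L · K_𝔯`):

* `SerreSL2.exists_prime_mul_eq_span_singleton` — **primes with a generator in a prescribed
  congruence class and of prescribed signs** (BMS (A.10)/(A.11), Vaserstein's "теорема Дирихле об
  арифметических прогрессиях"): for `𝔪 ≠ 0`, `𝔟 ≠ 0` prime to `𝔪` and `x ≠ 0` prime to `𝔪`
  there are, outside any finite set, primes `𝔭 ∤ 𝔪` of prime absolute norm with `𝔭 𝔟 = (π)`,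
  `π ≡ x (mod 𝔪)` and `σ(π) σ(x) > 0` at every real `σ`.  Derived from the tree's Landau theorem on
  primes in narrow ray classes (`LFunctions.exists_rayClassRel_prime_absNorm_not_mem`) and the
  finiteness of the narrow ray class group (`GaloisRepresentations.finite_rayClassGroup`).
* `SerreSL2.exists_prime_natCast_absNorm_eq` — **primes with prescribed norm class in the image of
  the cyclotomic character** (BMS (A.8): "`{𝔭 : N𝔭 ≢ 1 mod p^{n+1}}` is infinite"; Serre's use of
  Čebotarev for `K(z)/K`): for `N = K(ζ_m)` and `τ ∈ Gal(N/K)` there are, outside any finite set,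
  primes `𝔮 ∤ m` of prime norm with `N𝔮 ≡ χ_m(τ) (mod m)`.  Derived from the tree's PROVED
  Chebotarev theorem for cyclotomic extensions
  (`GaloisRepresentations.chebotarev_cyclotomicExtension_holds`) and `val_cycloChar_galFrob`.
* `SerreSL2.exists_cycloChar_ne_one` — if `K` has a real embedding and `3 ≤ m`, the cyclotomic
  character of `Gal(K(ζ_m)/K)` takes a value `≠ 1` (`ζ_m ∉ K`).

## References

* [BassMilnorSerre1967] H. Bass, J. Milnor, J.-P. Serre, Publ. Math. IHES 33 (1967), Appendix,
  (A.8), (A.10), (A.11); Ch. I Thm. 3.2.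
* [SerreSL2Congruence1970] J.-P. Serre, Ann. of Math. 92 (1970), §2.3 Lemme 3, Lemme 4.
* [Vaserstein1972SL2] L. N. Vaserstein, Mat. Sb. 89 (131) (1972), proofs of Lemma 3 (б) and Lemma 5.
-/

open NumberField IsDedekindDomain

namespace Literature.NumberTheory.Automorphic

namespace SerreSL2

open Literature.NumberTheory.LFunctions Literature.NumberTheory.GaloisRepresentations

variable {K : Type*} [Field K] [NumberField K]

/-! ### Powers of ray classes -/

omit [NumberField K] in
/-- A power of a nonzero ideal prime to `𝔪` is nonzero and prime to `𝔪`. [folklore] -/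
theorem pow_ne_bot_and_isCoprime {𝔪 : Ideal (𝓞 K)} (𝔟 : CoprimeIdeal 𝔪) (n : ℕ) :
    𝔟.1 ^ n ≠ ⊥ ∧ IsCoprime (𝔟.1 ^ n) 𝔪 :=
  ⟨pow_ne_zero n 𝔟.2.1, IsCoprime.pow_left 𝔟.2.2⟩

/-- `[𝔟ⁿ] = [𝔟]ⁿ` in the narrow ray class group. [folklore] -/
theorem integralRayClass_pow {𝔪 : Ideal (𝓞 K)} (h𝔪 : 𝔪 ≠ ⊥) (𝔟 : CoprimeIdeal 𝔪) (n : ℕ) :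
    integralRayClass 𝔪 h𝔪 ⟨𝔟.1 ^ n, pow_ne_bot_and_isCoprime 𝔟 n⟩ =
      integralRayClass 𝔪 h𝔪 𝔟 ^ n := by
  induction n with
  | zero =>
    have htop : (⊤ : Ideal (𝓞 K)) ≠ ⊥ ∧ IsCoprime (⊤ : Ideal (𝓞 K)) 𝔪 :=
      ⟨by simp, by rw [← Ideal.one_eq_top]; exact isCoprime_one_left⟩
    rw [show integralRayClass 𝔪 h𝔪 𝔟 ^ 0 = 1 from pow_zero _, ← integralRayClass_top h𝔪 htop]
    exact integralRayClass_congr h𝔪 (by simp [Ideal.one_eq_top])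
  | succ n ih =>
    have hmul : 𝔟.1 ^ n * 𝔟.1 ≠ ⊥ ∧ IsCoprime (𝔟.1 ^ n * 𝔟.1) 𝔪 := by
      rw [← pow_succ]; exact pow_ne_bot_and_isCoprime 𝔟 (n + 1)
    rw [show integralRayClass 𝔪 h𝔪 𝔟 ^ (n + 1) = integralRayClass 𝔪 h𝔪 𝔟 ^ n *
        integralRayClass 𝔪 h𝔪 𝔟 from pow_succ _ _, ← ih,
      ← integralRayClass_mul h𝔪 ⟨𝔟.1 ^ n, pow_ne_bot_and_isCoprime 𝔟 n⟩ 𝔟 hmul]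
    exact integralRayClass_congr h𝔪 (by simp [pow_succ])

/-- Some power `𝔟ᴺ`, `N = #Cl_K^𝔪 ≥ 1`, of an ideal prime to `𝔪` lies in the principal narrow ray
class: `(c) 𝔟ᴺ = (b)` with `b ≡ c (mod 𝔪)`, `c` prime to `𝔪`, `b/c ≫ 0`. [folklore] -/
theorem rayClassRel_top_pow_card {𝔪 : Ideal (𝓞 K)} (h𝔪 : 𝔪 ≠ ⊥) (𝔟 : CoprimeIdeal 𝔪) :
    RayClassRel 𝔪 ⊤ (𝔟.1 ^ Nat.card (RayClassGroup 𝔪)) := by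
  haveI : Finite (RayClassGroup 𝔪) := finite_rayClassGroup h𝔪
  have htop : (⊤ : Ideal (𝓞 K)) ≠ ⊥ ∧ IsCoprime (⊤ : Ideal (𝓞 K)) 𝔪 :=
    ⟨by simp, by rw [← Ideal.one_eq_top]; exact isCoprime_one_left⟩
  have h := (integralRayClass_eq_iff h𝔪
    ⟨𝔟.1 ^ Nat.card (RayClassGroup 𝔪), pow_ne_bot_and_isCoprime 𝔟 _⟩ ⟨⊤, htop⟩).mp
  apply h
  rw [integralRayClass_top h𝔪 htop, integralRayClass_pow, pow_card_eq_one']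

/-! ### Dirichlet's theorem with a generator: BMS (A.10)/(A.11) -/

/-- **Primes with a generator in a prescribed class and of prescribed signs** (Bass–Milnor–Serre,
Appendix (A.10)–(A.11); the "Dirichlet theorem" of Vaserstein 1972 and of Serre 1970, §2.3): let
`𝔪 ≠ 0`, let `𝔟 ≠ 0` be prime to `𝔪` and let `x ≠ 0` be prime to `𝔪`.  Then outside any finite set
`S` there is a prime `𝔭 ∤ 𝔪` of prime absolute norm such that `𝔭 𝔟 = (π)` is principal with
`π ≡ x (mod 𝔪)` and `σ(π) σ(x) > 0` for every real embedding `σ`.  (Landau's theorem applied to the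
narrow class of `(x) 𝔟ᴺ⁻¹`, `N = #Cl_K^𝔪`, using `(c') 𝔟ᴺ = (b')` in the principal class.)
[cite: BassMilnorSerre1967, Appendix (A.10), (A.11)] -/
theorem exists_prime_mul_eq_span_singleton {𝔪 : Ideal (𝓞 K)} (h𝔪 : 𝔪 ≠ ⊥) {𝔟 : Ideal (𝓞 K)}
    (h𝔟 : 𝔟 ≠ ⊥) (h𝔟𝔪 : IsCoprime 𝔟 𝔪) {x : 𝓞 K} (hx : x ≠ 0)
    (hx𝔪 : IsCoprime (Ideal.span {x}) 𝔪) (S : Set (HeightOneSpectrum (𝓞 K))) (hS : S.Finite) :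
    ∃ v : HeightOneSpectrum (𝓞 K), v ∉ S ∧ ¬ 𝔪 ≤ v.asIdeal ∧ (Ideal.absNorm v.asIdeal).Prime ∧
      ∃ π : 𝓞 K, v.asIdeal * 𝔟 = Ideal.span {π} ∧ π - x ∈ 𝔪 ∧
        ∀ φ : K →+* ℝ, 0 < φ π * φ x := by
  haveI : Finite (RayClassGroup 𝔪) := finite_rayClassGroup h𝔪
  set n : ℕ := Nat.card (RayClassGroup 𝔪) with hn
  have hnpos : 0 < n := Nat.card_pos
  let 𝔟c : CoprimeIdeal 𝔪 := ⟨𝔟, h𝔟, h𝔟𝔪⟩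
  -- the auxiliary ideal `(x) 𝔟ⁿ⁻¹`
  have h𝔠 : Ideal.span {x} * 𝔟 ^ (n - 1) ≠ ⊥ ∧ IsCoprime (Ideal.span {x} * 𝔟 ^ (n - 1)) 𝔪 :=
    ⟨mul_ne_zero (by rw [Ne, Ideal.zero_eq_bot, Ideal.span_singleton_eq_bot]; exact hx)
        (pow_ne_zero _ h𝔟),
      IsCoprime.mul_left hx𝔪 (IsCoprime.pow_left h𝔟𝔪)⟩
  obtain ⟨v, hvS, hv𝔪, hrel, hprime⟩ :=
    exists_rayClassRel_prime_absNorm_not_mem h𝔪 ⟨_, h𝔠⟩ S hS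
  obtain ⟨b, c, hb, hc, hccop, hbc, hpos, heq⟩ := hrel
  obtain ⟨b', c', hb', hc', hc'cop, hb'c', hpos', heq'⟩ := rayClassRel_top_pow_card h𝔪 𝔟c
  refine ⟨v, hvS, hv𝔪, hprime, ?_⟩
  -- `(c c') (v 𝔟) = (b b' x)`
  have hpow : 𝔟 ^ (n - 1) * 𝔟 = 𝔟 ^ n := by
    rw [← pow_succ, Nat.sub_add_cancel hnpos]
  have hideal : Ideal.span {c * c'} * (v.asIdeal * 𝔟) = Ideal.span {b * b' * x} := by
    have heq2 : Ideal.span {c} * v.asIdeal = Ideal.span {b} * (Ideal.span {x} * 𝔟 ^ (n - 1)) := heq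
    have e1 : Ideal.span {c} * (v.asIdeal * 𝔟) = Ideal.span {b * x} * 𝔟 ^ n := by
      rw [← mul_assoc, heq2, ← Ideal.span_singleton_mul_span_singleton, ← hpow]; ring
    have e2 : Ideal.span {c'} * 𝔟 ^ n = Ideal.span {b'} := by
      have h2 := heq'
      rw [Ideal.mul_top] at h2
      exact h2
    calc Ideal.span {c * c'} * (v.asIdeal * 𝔟)
        = Ideal.span {c'} * (Ideal.span {c} * (v.asIdeal * 𝔟)) := by
          rw [← Ideal.span_singleton_mul_span_singleton]; ring
      _ = Ideal.span {c'} * (Ideal.span {b * x} * 𝔟 ^ n) := by rw [e1]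
      _ = Ideal.span {b * x} * (Ideal.span {c'} * 𝔟 ^ n) := by ring
      _ = Ideal.span {b * x} * Ideal.span {b'} := by rw [e2]
      _ = Ideal.span {b * b' * x} := by
          rw [Ideal.span_singleton_mul_span_singleton]; ring_nf
  -- extract the generator `π`
  have hmem : b * b' * x ∈ Ideal.span {c * c'} := by
    have : b * b' * x ∈ Ideal.span {c * c'} * (v.asIdeal * 𝔟) := by
      rw [hideal]; exact Ideal.mem_span_singleton_self _
    exact Ideal.mul_le_right this
  obtain ⟨π, hπ⟩ := Ideal.mem_span_singleton'.1 hmem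
  -- `hπ : π * (c * c') = b * b' * x`
  have hcc' : c * c' ≠ 0 := mul_ne_zero hc hc'
  have hspan : v.asIdeal * 𝔟 = Ideal.span {π} := by
    have h1 : Ideal.span {c * c'} * Ideal.span {π} = Ideal.span {c * c'} * (v.asIdeal * 𝔟) := by
      rw [hideal, Ideal.span_singleton_mul_span_singleton, mul_comm, hπ]
    have hne : Ideal.span {c * c'} ≠ 0 := by
      rw [Ne, Ideal.zero_eq_bot, Ideal.span_singleton_eq_bot]; exact hcc'
    exact (mul_left_cancel₀ hne h1).symm
  refine ⟨π, hspan, ?_, fun φ ↦ ?_⟩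
  · -- `π ≡ x (mod 𝔪)`: `c c' (π - x) = (b b' - c c') x ∈ 𝔪` and `c c'` is prime to `𝔪`
    have hdiff : c * c' * (π - x) ∈ 𝔪 := by
      have : c * c' * (π - x) = (b * (b' - c') + c' * (b - c)) * x := by
        have := hπ; linear_combination this
      rw [this]
      exact 𝔪.mul_mem_right _ (𝔪.add_mem (𝔪.mul_mem_left _ hb'c') (𝔪.mul_mem_left _ hbc))
    have hcop : IsCoprime (Ideal.span {c * c'}) 𝔪 := by
      rw [← Ideal.span_singleton_mul_span_singleton]
      exact IsCoprime.mul_left hccop hc'cop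
    obtain ⟨r, hr, s, hs, hrs⟩ := Ideal.isCoprime_iff_exists.mp hcop
    obtain ⟨t, rfl⟩ := Ideal.mem_span_singleton'.1 hr
    have : π - x = t * (c * c' * (π - x)) + s * (π - x) := by
      have := hrs; linear_combination -(this * (π - x))
    rw [this]
    exact 𝔪.add_mem (𝔪.mul_mem_left _ hdiff) (𝔪.mul_mem_right _ hs)
  · -- signs: `φ(c) φ(c') φ(π) = φ(b) φ(b') φ(x)`
    have hK : (π : K) * ((c : K) * (c' : K)) = (b : K) * (b' : K) * (x : K) := by
      have := congrArg (fun y : 𝓞 K ↦ (y : K)) hπ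
      push_cast at this
      exact this
    have hφ : φ π * (φ c * φ c') = φ b * φ b' * φ x := by
      have := congrArg φ hK
      simpa only [map_mul] using this
    have hxne : φ x ≠ 0 := by
      rw [map_ne_zero_iff φ φ.injective]
      exact RingOfIntegers.coe_ne_zero_iff.mpr hx
    have hcne : φ c * φ c' ≠ 0 := by
      rw [← map_mul, map_ne_zero_iff φ φ.injective]
      exact_mod_cast hcc'
    have key : φ π * φ x * (φ c * φ c') ^ 2 = (φ b * φ c) * (φ b' * φ c') * (φ x) ^ 2 := by
      have := hφ; linear_combination (φ x * (φ c * φ c')) * this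
    have hpos2 : 0 < (φ b * φ c) * (φ b' * φ c') * (φ x) ^ 2 :=
      mul_pos (mul_pos (hpos φ) (hpos' φ)) (by positivity)
    rw [← key] at hpos2
    exact (mul_pos_iff_of_pos_right (lt_of_le_of_ne (sq_nonneg _)
      (Ne.symm (pow_ne_zero 2 hcne)))).mp hpos2

/-! ### Chebotarev for `K(ζ_m)/K` in norm form: BMS (A.8) -/

/-- **Primes with prescribed norm residue in the image of the cyclotomic character**
(Bass–Milnor–Serre (A.8); Serre 1970, §2.3, proof of Lemme 3 via Čebotarev for `K(z)/K`): for
`N = K(ζ_m)` and `τ ∈ Gal(N/K)`, outside any finite set `S` there is a prime `𝔮 ∌ m` of prime absolute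
norm with `N𝔮 ≡ χ_m(τ) (mod m)`.  From the tree's Chebotarev theorem for cyclotomic extensions
(`chebotarev_cyclotomicExtension_holds`) and `χ_m(Frob_𝔮) = N𝔮 mod m` (`val_cycloChar_galFrob`).
[cite: BassMilnorSerre1967, Appendix (A.8)] -/
theorem exists_prime_natCast_absNorm_eq (K N : Type) [Field K] [NumberField K] [Field N]
    [NumberField N] [Algebra K N] (m : ℕ) [NeZero m] [IsCyclotomicExtension {m} K N]
    (τ : N ≃ₐ[K] N) (S : Set (HeightOneSpectrum (𝓞 K))) (hS : S.Finite) :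
    ∃ v : HeightOneSpectrum (𝓞 K), v ∉ S ∧ (m : 𝓞 K) ∉ v.asIdeal ∧
      (Ideal.absNorm v.asIdeal).Prime ∧
      ((Ideal.absNorm v.asIdeal : ℕ) : ZMod m) = ((cycloChar K N m τ : (ZMod m)ˣ) : ZMod m) := by
  haveI := isGalois_of_isCyclotomicExtension K N m
  have hinf := chebotarev_cyclotomicExtension_holds K N m τ
  have hfin : (S ∪ {v : HeightOneSpectrum (𝓞 K) | (m : 𝓞 K) ∈ v.asIdeal}).Finite :=
    hS.union finite_setOf_natCast_mem
  obtain ⟨v, ⟨hvprime, -, hvfrob⟩, hvnot⟩ := (hinf.sdiff hfin).nonempty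
  simp only [Set.mem_union, Set.mem_setOf_eq, not_or] at hvnot
  refine ⟨v, hvnot.1, hvnot.2, hvprime, ?_⟩
  obtain ⟨Q, hQ, hfrobQ⟩ := galFrob_spec K N v
  rw [← hvfrob Q hQ _ hfrobQ, val_cycloChar_galFrob K N m v hvnot.2]

/-! ### The cyclotomic character is non-trivial over a field with a real place -/

/-- **`ζ_m ∉ K` for `K` with a real embedding and `m ≥ 3`**: the cyclotomic character of
`Gal(K(ζ_m)/K)` takes some value `≠ 1` (otherwise `Gal(N/K) = 1`, `N = K` and `σ(ζ_m)` would be a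
real root of unity of order `m ≥ 3`). [folklore] -/
theorem exists_cycloChar_ne_one (K N : Type) [Field K] [NumberField K] [Field N] [NumberField N]
    [Algebra K N] (m : ℕ) [NeZero m] [IsCyclotomicExtension {m} K N] (hm : 3 ≤ m)
    (σ : K →+* ℝ) : ∃ τ : N ≃ₐ[K] N, cycloChar K N m τ ≠ 1 := by
  haveI := isGalois_of_isCyclotomicExtension K N m
  by_contra h
  simp only [not_exists, not_not] at h
  -- all of `Gal(N/K)` is trivial, hence `[N : K] = 1` and `ζ ∈ K`
  have htriv : ∀ τ : N ≃ₐ[K] N, τ = 1 := fun τ ↦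
    cycloChar_injective K N m (by rw [h τ, map_one])
  have hcard : Module.finrank K N = 1 := by
    rw [← IsGalois.card_aut_eq_finrank, Nat.card_eq_one_iff_exists]
    exact ⟨1, fun τ ↦ htriv τ⟩
  set ζ := IsCyclotomicExtension.zeta m K N with hζdef
  have hζ := IsCyclotomicExtension.zeta_spec m K N
  have hbot : (⊥ : Subalgebra K N) = ⊤ := Subalgebra.bot_eq_top_of_finrank_eq_one hcard
  have hζmem : ζ ∈ (⊥ : Subalgebra K N) := by rw [hbot]; exact Algebra.mem_top
  obtain ⟨z, hz⟩ := Algebra.mem_bot.mp hζmem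
  -- `z` is a primitive `m`-th root of unity in `K`, `σ z` one in `ℝ`
  have hzprim : IsPrimitiveRoot z m := by
    have h3 : IsPrimitiveRoot (algebraMap K N z) m := by rw [hz]; exact hζ
    exact h3.of_map_of_injective (algebraMap K N).injective
  have hreal : IsPrimitiveRoot (σ z) m := hzprim.map_of_injective σ.injective
  -- a real root of unity is `±1`, of order `≤ 2`
  have hsq : (σ z) ^ 2 = 1 := by
    have h1 : (σ z) ^ m = 1 := hreal.pow_eq_one
    have habs : |σ z| = 1 := by
      have := congrArg (fun t : ℝ ↦ |t|) h1
      simp only [abs_pow, abs_one] at this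
      exact (pow_eq_one_iff_of_nonneg (abs_nonneg _) (NeZero.ne m)).mp this
    rcases abs_eq (zero_le_one' ℝ) |>.mp habs with h | h <;> rw [h] <;> norm_num
  have hdvd := hreal.dvd_of_pow_eq_one 2 hsq
  have : m ≤ 2 := Nat.le_of_dvd two_pos hdvd
  omega

end SerreSL2

end Literature.NumberTheory.Automorphic
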